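import Summits.CriticalPhenomena.CardyFormulaZ2.Theorems.CardyTensorRGPolyominoGaussianLawSquareLimitPart3
import Literature.Probability.RandomPlanarGeometry.ModulusSymmetry
import Literature.Probability.RandomPlanarGeometry.CardyFunctionIncBeta

/-!
# The bond-`ℤ²` crossing probability of the unit square tends to `1/2` — Part 4:
# Cardy's formula, and the crux's law for EVERY exponent, hold for the unit square
# (crux `PolyominoGaussianLaw`, stmt-CriticalPhenomena-14337, route `CardyTensorRG`, line `registered`)

For the unit square with its corners marked — bottom-left corner first, crossed between two opposite
sides — every uniformizing datum has cross-ratio `1/2` (reflection in the diagonal; the tree's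
symmetry principle `ConformalRectangle.crossRatio_eq_half_of_antiAffine`), Cardy's function takes the
value `1/2` there (`cardyFunction_one_sub_holds`; cf. `cardyFunction_one_half` in the tree), and so does the crux's normalised incomplete beta law
`I_a` for every `a < 1` (`sq_betaLaw_half`, symmetry `s ↦ 1 - s` of the kernel). With Part 3
(`sq_unitSquare_tendsto_half`: the crossing probability tends to `1/2`) this gives:

* `sq_unitSquare_cardy` — **Cardy's formula on bond-`ℤ²` holds for the unit square**:
  `R.HasCrossingLimit (bondDomainCrossingProb R) cardyFunction` — the first conformal rectangle for
  which the sub-problem `CardyFormulaZ2` is a theorem of the tree;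
* `stub_unitSquareBetaLaw` (registered helper) — for every `a < 1` the unit square has crossing limit
  `I_a(cross-ratio)`: both open cores of the line (`stub_dyadicLimitExists`,
  `stub_dyadicLimitIsBetaLaw`) hold verbatim on the unit square, for every exponent.
-/

noncomputable section

open Set Metric Complex MeasureTheory Filter Topology
open Literature.Probability.Percolation (bondDomainCrossingProb)
open Literature.Probability.RandomPlanarGeometry

namespace Summit.CriticalPhenomena.CardyFormulaZ2.Cruxes.PolyominoGaussianLaw.Birth

/-! ### The value `1/2` of the limit laws at `η = 1/2` -/

/-- The kernel `(s(1-s))^{-a}` is interval-integrable on `[0, 1/2]` for `a < 1`. [folklore] -/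
theorem sq_intervalIntegrable_betaKernel_half {a : ℝ} (ha : a < 1) :
    IntervalIntegrable (fun s : ℝ => (s * (1 - s)) ^ (-a)) volume 0 (1 / 2) := by
  have h1 : IntervalIntegrable (fun s : ℝ => s ^ (-a)) volume 0 (1 / 2) :=
    intervalIntegral.intervalIntegrable_rpow' (by linarith)
  have h2 : ContinuousOn (fun s : ℝ => (1 - s) ^ (-a)) (Set.uIcc 0 (1 / 2)) := by
    refine ContinuousOn.rpow_const (continuousOn_const.sub continuousOn_id) fun s hs => Or.inl ?_
    rw [Set.uIcc_of_le (by norm_num : (0 : ℝ) ≤ 1 / 2)] at hs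
    have := hs.2
    intro h
    linarith
  refine (h1.mul_continuousOn h2).congr_uIoo fun s hs => ?_
  rw [Set.uIoo_of_le (by norm_num : (0 : ℝ) ≤ 1 / 2)] at hs
  simp only
  rw [Real.mul_rpow hs.1.le (by linarith [hs.2])]

/-- **`I_a(1/2) = 1/2`** for the normalised incomplete beta law of exponent `a < 1`: the kernel
`(s(1-s))^{-a}` is symmetric under `s ↦ 1 - s`, so `∫₀^{1/2} = ∫_{1/2}^1`. [folklore] -/
theorem sq_betaLaw_half {a : ℝ} (ha : a < 1) :
    intervalIntegral (fun s : ℝ => (s * (1 - s)) ^ (-a)) 0 (1 / 2) volume /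
      intervalIntegral (fun s : ℝ => (s * (1 - s)) ^ (-a)) 0 1 volume = 1 / 2 := by
  set k : ℝ → ℝ := fun s => (s * (1 - s)) ^ (-a) with hk
  have hhalf : IntervalIntegrable k volume 0 (1 / 2) := sq_intervalIntegrable_betaKernel_half ha
  -- the second half by symmetry
  have hsym : ∫ s in (1 / 2 : ℝ)..1, k s = ∫ s in (0 : ℝ)..(1 / 2), k s := by
    have h1 : ∫ s in (1 / 2 : ℝ)..1, k s = ∫ s in (1 / 2 : ℝ)..1, k (1 - s) := by
      refine intervalIntegral.integral_congr fun s _ => ?_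
      simp only [hk, sub_sub_cancel, mul_comm]
    rw [h1, intervalIntegral.integral_comp_sub_left (fun s => k s) 1]
    norm_num
  have hhalf' : IntervalIntegrable k volume (1 / 2) 1 := by
    have h := hhalf.comp_sub_left 1
    have e : (fun s => k (1 - s)) = k := by
      funext s; simp only [hk, sub_sub_cancel, mul_comm]
    rw [e] at h
    norm_num at h
    exact h.symm
  have htot : ∫ s in (0 : ℝ)..1, k s = 2 * ∫ s in (0 : ℝ)..(1 / 2), k s := by
    rw [← intervalIntegral.integral_add_adjacent_intervals hhalf hhalf', hsym]
    ring
  have hpos : 0 < ∫ s in (0 : ℝ)..(1 / 2), k s := by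
    refine intervalIntegral.intervalIntegral_pos_of_pos_on hhalf (fun s hs => ?_) (by norm_num)
    simp only [hk]
    exact Real.rpow_pos_of_pos (mul_pos hs.1 (by linarith [hs.2])) _
  show (∫ s in (0 : ℝ)..(1 / 2), k s) / (∫ s in (0 : ℝ)..1, k s) = 1 / 2
  rw [htot]
  field_simp

/-! ### Cross-ratio `1/2` of the marked unit square -/

/-- **The unit square with its corners marked from the bottom-left one has cross-ratio `1/2`** for
every uniformizing datum: the reflection `z ↦ i z̄` in the diagonal preserves `(0,1)²`, fixes
`pt 0 = 0`, `pt 2 = 1 + i` and swaps `pt 1 ↔ pt 3` (`= 1, i` in either order). [folklore] -/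
theorem sq_crossRatio_unitSquare (R : ConformalRectangle)
    (hRc : R.carrier = Ioo (0 : ℝ) 1 ×ℂ Ioo (0 : ℝ) 1) (h0 : R.pt 0 = 0) (h2 : R.pt 2 = 1 + Complex.I)
    (h13 : (R.pt 1 = 1 ∧ R.pt 3 = Complex.I) ∨ (R.pt 1 = Complex.I ∧ R.pt 3 = 1))
    {φ : ConformalEquiv UpperHalfPlane.upperHalfPlaneSet R.carrier} {x : Fin 4 → ℝ}
    (h : R.IsUniformizing φ x) : crossRatio x = 1 / 2 := by
  have hsw : ∀ z : ℂ, antiAffine Complex.I 0 z = ⟨z.im, z.re⟩ := fun z => by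
    apply Complex.ext <;> simp [antiAffine]
  refine ConformalRectangle.crossRatio_eq_half_of_antiAffine R (u := Complex.I) (v := 0)
    (by simp) (by simp) ?_ ?_ ?_ ?_ h
  · intro z hz
    rw [hRc, Complex.mem_reProdIm] at hz ⊢
    rw [hsw]
    exact ⟨hz.2, hz.1⟩
  · rw [h0, hsw]; apply Complex.ext <;> simp
  · rw [h2, hsw]; apply Complex.ext <;> simp
  · rcases h13 with ⟨h1, h3⟩ | ⟨h1, h3⟩ <;> rw [h1, h3, hsw] <;> apply Complex.ext <;> simp

/-! ### Cardy's formula and the crux's law for the unit square -/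

/-- **Cardy's formula on bond-`ℤ²` holds for the unit square** (corners marked from the bottom-left
one, crossed between the left/right or the bottom/top sides): `bondDomainCrossingProb R δ → F(η)` as
`δ → 0⁺`, both sides being `1/2`. [folklore] -/
theorem sq_unitSquare_cardy (R : ConformalRectangle)
    (hRc : R.carrier = Ioo (0 : ℝ) 1 ×ℂ Ioo (0 : ℝ) 1) (h0 : R.pt 0 = 0) (h2 : R.pt 2 = 1 + Complex.I)
    (h13 : (R.pt 1 = 1 ∧ R.pt 3 = Complex.I) ∨ (R.pt 1 = Complex.I ∧ R.pt 3 = 1))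
    (harcs : (R.arc 0 = {z : ℂ | z.re = 0 ∧ z.im ∈ Icc (0 : ℝ) 1} ∧
        R.arc 2 = {z : ℂ | z.re = 1 ∧ z.im ∈ Icc (0 : ℝ) 1}) ∨
      (R.arc 0 = {z : ℂ | z.im = 0 ∧ z.re ∈ Icc (0 : ℝ) 1} ∧
        R.arc 2 = {z : ℂ | z.im = 1 ∧ z.re ∈ Icc (0 : ℝ) 1})) :
    R.HasCrossingLimit (bondDomainCrossingProb R) Literature.Probability.RandomPlanarGeometry.cardyFunction := by
  intro φ x hφ
  -- `F(1/2) = 1/2` (duality `F(1-η) = 1 - F(η)`; also `cardyFunction_one_half` elsewhere in the tree)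
  have hF : Literature.Probability.RandomPlanarGeometry.cardyFunction (1 / 2) = 1 / 2 := by
    have h := cardyFunction_one_sub_holds (η := 1 / 2) ⟨by norm_num, by norm_num⟩
    norm_num at h
    linarith
  rw [sq_crossRatio_unitSquare R hRc h0 h2 h13 hφ, hF]
  exact sq_unitSquare_tendsto_half R hRc harcs

/-- **The crux's law holds on the unit square for EVERY exponent `a < 1`** (registered helper stub
`stub_unitSquareBetaLaw`): the bond-`ℤ²` crossing probability of the marked unit square tends, as
`δ → 0⁺`, to `I_a(cross-ratio) = I_a(1/2) = 1/2` for every uniformizing datum. So both open cores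
of the line hold verbatim on the unit square. [folklore] -/
theorem stub_unitSquareBetaLaw :
    ∀ a : ℝ, a < 1 → ∀ R : Literature.Probability.RandomPlanarGeometry.ConformalRectangle,
      R.carrier = (Set.Ioo (0 : ℝ) 1 ×ℂ Set.Ioo (0 : ℝ) 1) → R.pt 0 = 0 → R.pt 2 = 1 + Complex.I →
      ((R.pt 1 = 1 ∧ R.pt 3 = Complex.I) ∨ (R.pt 1 = Complex.I ∧ R.pt 3 = 1)) →
      ((R.arc 0 = {z : ℂ | z.re = 0 ∧ z.im ∈ Set.Icc (0 : ℝ) 1} ∧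
          R.arc 2 = {z : ℂ | z.re = 1 ∧ z.im ∈ Set.Icc (0 : ℝ) 1}) ∨
        (R.arc 0 = {z : ℂ | z.im = 0 ∧ z.re ∈ Set.Icc (0 : ℝ) 1} ∧
          R.arc 2 = {z : ℂ | z.im = 1 ∧ z.re ∈ Set.Icc (0 : ℝ) 1})) →
      R.HasCrossingLimit (Literature.Probability.Percolation.bondDomainCrossingProb R)
        (fun η : ℝ => intervalIntegral (fun s : ℝ => (s * (1 - s)) ^ (-a)) 0 η MeasureTheory.volume /
          intervalIntegral (fun s : ℝ => (s * (1 - s)) ^ (-a)) 0 1 MeasureTheory.volume) := by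
  intro a ha R hRc h0 h2 h13 harcs φ x hφ
  show Tendsto (bondDomainCrossingProb R) (𝓝[>] 0)
    (𝓝 (intervalIntegral (fun s : ℝ => (s * (1 - s)) ^ (-a)) 0 (crossRatio x) volume /
      intervalIntegral (fun s : ℝ => (s * (1 - s)) ^ (-a)) 0 1 volume))
  rw [sq_crossRatio_unitSquare R hRc h0 h2 h13 hφ, sq_betaLaw_half ha]
  exact sq_unitSquare_tendsto_half R hRc harcs

/-- **The marked unit squares exist as conformal rectangles of the tree** (so the two theorems above
are not vacuous): bottom-to-top `rectQuad 0 1 0 1` and its coordinate swap, left-to-right. [folklore] -/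
theorem sq_exists_markedUnitSquares :
    (∃ R : ConformalRectangle, R.carrier = Ioo (0 : ℝ) 1 ×ℂ Ioo (0 : ℝ) 1 ∧ R.pt 0 = 0 ∧
      R.pt 2 = 1 + Complex.I ∧ (R.pt 1 = 1 ∧ R.pt 3 = Complex.I) ∧
      R.arc 0 = {z : ℂ | z.im = 0 ∧ z.re ∈ Icc (0 : ℝ) 1} ∧
      R.arc 2 = {z : ℂ | z.im = 1 ∧ z.re ∈ Icc (0 : ℝ) 1}) ∧
    (∃ R : ConformalRectangle, R.carrier = Ioo (0 : ℝ) 1 ×ℂ Ioo (0 : ℝ) 1 ∧ R.pt 0 = 0 ∧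
      R.pt 2 = 1 + Complex.I ∧ (R.pt 1 = Complex.I ∧ R.pt 3 = 1) ∧
      R.arc 0 = {z : ℂ | z.re = 0 ∧ z.im ∈ Icc (0 : ℝ) 1} ∧
      R.arc 2 = {z : ℂ | z.re = 1 ∧ z.im ∈ Icc (0 : ℝ) 1}) := by
  set R₀ : ConformalRectangle := Literature.Probability.Percolation.rectQuad 0 1 0 1 zero_lt_one zero_lt_one
    with hR₀
  have harc0 : R₀.arc 0 = {z : ℂ | z.im = 0 ∧ z.re ∈ Icc (0 : ℝ) 1} :=
    Set.ext fun z => Literature.Probability.Percolation.mem_rectQuad_arc_zero zero_lt_one zero_lt_one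
  have harc1 : R₀.arc 1 = {z : ℂ | z.re = 1 ∧ z.im ∈ Icc (0 : ℝ) 1} :=
    Set.ext fun z => Literature.Probability.Percolation.mem_rectQuad_arc_one zero_lt_one zero_lt_one
  have harc2 : R₀.arc 2 = {z : ℂ | z.im = 1 ∧ z.re ∈ Icc (0 : ℝ) 1} :=
    Set.ext fun z => Literature.Probability.Percolation.mem_rectQuad_arc_two zero_lt_one zero_lt_one
  have harc3 : R₀.arc 3 = {z : ℂ | z.re = 0 ∧ z.im ∈ Icc (0 : ℝ) 1} :=
    Set.ext fun z => Literature.Probability.Percolation.mem_rectQuad_arc_three zero_lt_one zero_lt_one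
  have a0 := R₀.pt_mem_arc_self 0
  have a1 := R₀.pt_mem_arc_self 1
  have a2 := R₀.pt_mem_arc_self 2
  have a3 := R₀.pt_mem_arc_self 3
  have b3 : R₀.pt 0 ∈ R₀.arc 3 := by simpa using R₀.pt_succ_mem_arc 3
  have b0 : R₀.pt 1 ∈ R₀.arc 0 := by simpa using R₀.pt_succ_mem_arc 0
  have b1 : R₀.pt 2 ∈ R₀.arc 1 := by simpa using R₀.pt_succ_mem_arc 1
  have b2 : R₀.pt 3 ∈ R₀.arc 2 := by simpa using R₀.pt_succ_mem_arc 2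
  rw [harc0] at a0 b0
  rw [harc1] at a1 b1
  rw [harc2] at a2 b2
  rw [harc3] at a3 b3
  have p0 : R₀.pt 0 = 0 := by apply Complex.ext <;> simp [a0.1, b3.1]
  have p1 : R₀.pt 1 = 1 := by apply Complex.ext <;> simp [a1.1, b0.1]
  have p2 : R₀.pt 2 = 1 + Complex.I := by apply Complex.ext <;> simp [a2.1, b1.1]
  have p3 : R₀.pt 3 = Complex.I := by apply Complex.ext <;> simp [a3.1, b2.1]
  refine ⟨⟨R₀, by rw [hR₀, Literature.Probability.Percolation.rectQuad_carrier], p0, p2, ⟨p1, p3⟩,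
    harc0, harc2⟩, ?_⟩
  obtain ⟨S, hS⟩ := sq_exists_swap
  refine ⟨R₀.map S, ?_, ?_, ?_, ⟨?_, ?_⟩, ?_, ?_⟩
  · rw [MarkedDomain.carrier_map, hR₀, Literature.Probability.Percolation.rectQuad_carrier,
      sq_image_swap_reProdIm hS]
  · rw [MarkedDomain.pt_map, p0, hS]; apply Complex.ext <;> simp
  · rw [MarkedDomain.pt_map, p2, hS]; apply Complex.ext <;> simp
  · rw [MarkedDomain.pt_map, p1, hS]; apply Complex.ext <;> simp
  · rw [MarkedDomain.pt_map, p3, hS]; apply Complex.ext <;> simp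
  · rw [MarkedDomain.arc_map, harc0]
    ext w
    simp only [mem_image, mem_setOf_eq]
    constructor
    · rintro ⟨z, ⟨h1, h2⟩, rfl⟩; rw [hS]; exact ⟨h1, h2⟩
    · rintro ⟨h1, h2⟩; exact ⟨⟨w.im, w.re⟩, ⟨h1, h2⟩, by rw [hS]⟩
  · rw [MarkedDomain.arc_map, harc2]
    ext w
    simp only [mem_image, mem_setOf_eq]
    constructor
    · rintro ⟨z, ⟨h1, h2⟩, rfl⟩; rw [hS]; exact ⟨h1, h2⟩
    · rintro ⟨h1, h2⟩; exact ⟨⟨w.im, w.re⟩, ⟨h1, h2⟩, by rw [hS]⟩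

end Summit.CriticalPhenomena.CardyFormulaZ2.Cruxes.PolyominoGaussianLaw.Birth
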